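import Summits.BirchSwinnertonDyer.Rank1Residual.Additive.X3BranchThreeLineCertificate
import Summits.BirchSwinnertonDyer.Rank1Residual.Additive.X3BranchLineCharacterPrimeDisc
import Summits.BirchSwinnertonDyer.Rank1Residual.Additive.X3BranchQuotCharacter
import HarnessLib

/-!
# X3 at `p = 3`, DISPLAY form: the per-pair Hesse-type line certificate `(x₀, s, D, q)` with its KERNEL
# FIELD `ℚ(√D)` exposed, and — for `D = q` a prime `≡ 1 (mod 4)` — the two CHARACTERS of the line and
# of the quotient as explicit primitive Dirichlet characters acting as required by
# `X3BranchResidualCountOfCharacters.lean` (cell `bsd-eis`, seat `bsd-eis-x3` gen 3; supports only)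

HONEST FRAMING (cell `bsd-eis`, `run/shared/lean/pub/bsd-eis/README.md` §4): THEOREMS ONLY; nothing
booked. bsd-addord's `exists_lineDatum_three_of_cert` (`X3BranchThreeLineCertificate.lean`) turns the
certificate into the four line hypotheses (`Φ₀` rational, EVEN, non-trivial action, ramified
`χ_K`-twist) but hides the kernel field; the display form of the certificate road also needs the
CHARACTERS of `Φ₀` and `W[3]/Φ₀`. §1 re-runs their proof keeping the kernel-field clause
"`σ` fixes `Φ₀` pointwise iff `σ` fixes `√D`" for the SAME `Φ₀`; §2, for `D = q` prime, `q ≡ 1 (mod 4)`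
(so `ℚ(√D) = ℚ(√q*)`; e.g. `450d2`, `2925e2`: `q = 5`; the ANOMALOUS `3042f2`: `q = 13`), adds
`hφ0` for `φ = (·/q)` in `𝔽₃` (mod `q`, primitive — `X3BranchLineCharacterPrimeDisc.lean`) and `hψ0`
for `ψ = ω₃·φ⁻¹` (mod `3q`, primitive — `X3BranchQuotCharacter.lean`). With these, a display on such a
row owes only: the class binders of record, the Q6 unit-coefficient record `hcert`, the two
`λ`-certificates `hCcert`/`hDcert` for THESE `φ`, `ψ` (Bernoulli-sum valuations,
`CharacterLambdaCertificateProofs.lean`) and the bookkeeping `hab`.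

* §1 `exists_lineDatum_three_kernelField_of_cert`;
* §2 `exists_lineDatum_three_characters_of_cert_prime`.

References: [GreenbergVatsal2000] §2 p. 28; [IrelandRosen1990] Ch. 6 Prop. 6.3.2; [Washington1997] Ch. 3.
-/

set_option autoImplicit false

noncomputable section

open scoped Classical NumberField

namespace Summit.BirchSwinnertonDyer.Rank1Residual.Additive

open WeierstrassCurve Polynomial NumberField IsDedekindDomain Field DirichletCharacter
  Literature.NumberTheory.GaloisRepresentations
  Literature.NumberTheory.EllipticCurves
  Literature.NumberTheory.EllipticCurves.Rank1Residual
  Summit.BirchSwinnertonDyer.Rank1Residual.GaloisImage.RamifiedOrdinaryLineTwist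

variable {W : WeierstrassCurve ℚ} [W.IsElliptic]

/-! ### §1 The line certificate with its kernel field -/

/-- **Per-pair certificate of the `p = 3` line datum, kernel field exposed.** As bsd-addord's
`exists_lineDatum_three_of_cert` (`Ψ₃(x₀) = 0`, `D` squarefree, `s ≠ 0`, `D·s² = Ψ₂Sq(x₀)`, `0 < D`,
an odd prime `q ∣ D`, `3 ∤ D`), with the additional clause that `σ ∈ Γ_ℚ` fixes `Φ₀` pointwise iff it
fixes `√D` (the kernel field of the even line is `ℚ(√D)`) — for the SAME `Φ₀`. The proof is theirs
verbatim (`KernelDisc.exists_isRationalLine_kernelChar_of_cert` and its consequences). [folklore] -/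
theorem exists_lineDatum_three_kernelField_of_cert [hp : Fact (Nat.Prime 3)] {x₀ s : ℚ} {D : ℤ}
    (hψ : W.Ψ₃.eval x₀ = 0) (hsq : Squarefree D) (hs : s ≠ 0)
    (hDs : (D : ℚ) * s ^ 2 = W.Ψ₂Sq.eval x₀) (hpos : 0 < D)
    (q : ℕ) [hq : Fact q.Prime] (hq2 : q ≠ 2) (hqD : (q : ℤ) ∣ D) (h3D : ¬ (3 : ℤ) ∣ D) :
    ∃ Φ₀ : AddSubgroup (geomTorsion W ((3 : ℕ) : ℤ)), IsRationalLine W 3 Φ₀ ∧ LineEven W 3 Φ₀ ∧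
      (∃ (σ : absoluteGaloisGroup ℚ) (P : W.geomTorsion ((3 : ℕ) : ℤ)), P ∈ Φ₀ ∧ σ • P ≠ P) ∧
      (∀ (K : Type) [Field K] [NumberField K] [(galRange (K := ℚ) K).Normal],
        Module.finrank ℚ K = 2 →
        (∃ θ : K, θ ^ 2 = algebraMap ℚ K ((-1) ^ ((3 : ℕ) / 2) * (3 : ℕ))) →
        ¬ ∀ v : HeightOneSpectrum (𝓞 ℚ), (((3 : ℕ) : ℕ) : 𝓞 ℚ) ∈ v.asIdeal →
          ∀ 𝔓 ∈ v.primesAbove, ∀ σ ∈ 𝔓.inertia (absoluteGaloisGroup ℚ), ∀ P ∈ Φ₀,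
            σ • P = (if σ ∈ galRange (K := ℚ) K then P else -P)) ∧
      ∀ σ : absoluteGaloisGroup ℚ, (∀ Q ∈ Φ₀, σ • Q = Q) ↔ σ • geomSqrt (D : ℚ) = geomSqrt (D : ℚ) := by
  have hD0 : D ≠ 0 := hsq.ne_zero
  have hD0' : (D : ℚ) ≠ 0 := by exact_mod_cast hD0
  obtain ⟨Φ, hΦ, hχ⟩ := KernelDisc.exists_isRationalLine_kernelChar_of_cert hψ hD0 hs hDs
  -- a non-zero point of the line
  haveI : Finite Φ := Nat.finite_of_card_ne_zero (by rw [hΦ.1]; decide)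
  haveI : Nontrivial Φ := Finite.one_lt_card_iff_nontrivial.mp (by rw [hΦ.1]; decide)
  obtain ⟨⟨P₀, hP₀⟩, hP₀ne⟩ := exists_ne (0 : Φ)
  have hP₀0 : P₀ ≠ 0 := fun h ↦ hP₀ne (Subtype.ext h)
  refine ⟨Φ, hΦ, KernelDisc.lineEven_of_pos hχ hpos, ?_, ?_, hχ⟩
  · -- non-trivial action: the Kummer element at the odd prime `q ∣ D` negates `√D`
    obtain ⟨v, hv⟩ :=
      Literature.NumberTheory.NumberFields.RingOfIntegers.exists_heightOneSpectrum_natCast_mem ℚ hq.out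
    obtain ⟨𝔓, h𝔓⟩ := HeightOneSpectrum.primesAbove_nonempty v
    have hval := KernelDisc.intValuation_intCast_eq_exp_neg_one_of_squarefree (p := q) hsq hqD hv
    have h2 : (2 : 𝓞 ℚ) ∉ v.asIdeal := two_not_mem_of_natCast_prime_mem hq.out hq2 hv
    obtain ⟨σ, -, hneg⟩ := exists_mem_inertia_smul_geomSqrt_eq_neg hval h2 h𝔓
    have hcast : ((D : 𝓞 ℚ) : ℚ) = (D : ℚ) := by simp
    rw [hcast] at hneg
    refine ⟨σ, P₀, hP₀, fun hfix ↦ ?_⟩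
    have hall : ∀ Q ∈ Φ, σ • Q = Q := (KernelDisc.forall_smul_eq_iff_of_mem hΦ hP₀ hP₀0 σ).mpr hfix
    have h := (hχ σ).mp hall
    rw [h] at hneg
    exact geomSqrt_ne_neg hD0' hneg
  · -- the `χ_K`-twist is ramified at `3`: an inertia element at `3` fixes `Φ` but negates `√−3`
    intro K _ _ _ h2K hθ hall
    obtain ⟨θ, hθ⟩ := hθ
    obtain ⟨v, hv⟩ :=
      Literature.NumberTheory.NumberFields.RingOfIntegers.exists_heightOneSpectrum_natCast_mem ℚ hp.out
    obtain ⟨σ, hσI, hσneg⟩ := exists_mem_absInertia_smul_geomSqrt_pStar_eq_neg 3 (by decide) hv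
    set τ : absoluteGaloisGroup ℚ := absGaloisRestrict ℚ (v.adicCompletion ℚ) σ with hτ
    have hτI : τ ∈ (adicCompletionPrime ℚ v).inertia (absoluteGaloisGroup ℚ) := by
      rw [inertia_adicCompletionPrime_eq_map_absInertia]
      exact Subgroup.mem_map.2 ⟨σ, hσI, rfl⟩
    have hfixD : τ • geomSqrt ((D : ℤ) : ℚ) = geomSqrt ((D : ℤ) : ℚ) :=
      smul_geomSqrt_eq_of_mem_inertia (p := 3) (not_dvd_four_mul (by decide) h3D) hv
        (adicCompletionPrime_mem_primesAbove ℚ v) hτI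
    have hfixΦ : τ • P₀ = P₀ := (hχ τ).mpr hfixD P₀ hP₀
    have hsqθ := embIntoClosure_sq K hθ
    have hsqr := geomSqrt_sq ((-1 : ℚ) ^ ((3 : ℕ) / 2) * (3 : ℕ))
    have hpm : embIntoClosure (K := ℚ) K θ = geomSqrt ((-1 : ℚ) ^ ((3 : ℕ) / 2) * (3 : ℕ)) ∨
        embIntoClosure (K := ℚ) K θ = -geomSqrt ((-1 : ℚ) ^ ((3 : ℕ) / 2) * (3 : ℕ)) := by
      exact sq_eq_sq_iff_eq_or_eq_neg.mp (hsqθ.trans hsqr.symm)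
    have hr0 : geomSqrt ((-1 : ℚ) ^ ((3 : ℕ) / 2) * (3 : ℕ)) ≠
        -geomSqrt ((-1 : ℚ) ^ ((3 : ℕ) / 2) * (3 : ℕ)) := geomSqrt_ne_neg (by norm_num)
    have hτK : τ ∉ galRange (K := ℚ) K := by
      apply not_mem_galRange_of_smul_embIntoClosure_ne K
      rcases hpm with h | h
      · rw [h, hσneg]
        exact fun e ↦ hr0 e.symm
      · rw [h, smul_neg, hσneg, neg_neg]
        exact hr0
    have hτP := hall v hv (adicCompletionPrime ℚ v) (adicCompletionPrime_mem_primesAbove ℚ v) τ hτI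
      P₀ hP₀
    rw [if_neg hτK, hfixΦ] at hτP
    apply hP₀0
    refine X2.ResidualDevissageLine.eq_zero_of_two_nsmul_eq_zero (by decide) P₀
      (X2.ResidualDevissageLine.nsmul_eq_zero_of_mem_geomTorsion P₀) ?_
    rw [two_nsmul]
    nth_rewrite 2 [hτP]
    exact add_neg_cancel P₀

/-! ### §2 Prime kernel discriminant `D = q ≡ 1 (mod 4)`: the characters of the line and of the quotient -/

/-- **The line datum WITH ITS TWO CHARACTERS for a prime kernel discriminant `q ≡ 1 (mod 4)`.** From
the certificate `(x₀, s, D = q, q)` (`q` prime, `q % 4 = 1`, `q ≠ 3`): a rational `3`-line `Φ₀` which is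
even, has non-trivial action and ramified `χ_K`-twist (§1), on which `Γ_ℚ` acts through the PRIMITIVE
character `φ = (·/q)` read in `𝔽₃` (`X3Branch.smul_eq_legendre_of_kernel_sq_eq_primeStar`: `q* = q`),
and whose quotient `W[3]/Φ₀` carries the PRIMITIVE character `ψ = ω₃·φ⁻¹` of level `3q`
(`X3Branch.smul_sub_quotCharacter_mem`, `X3Branch.quotCharacter_isPrimitive`) — every LINE input of
the display form `X3Branch.residualCount_eq_pow_of_charFacts_of_characters`. [folklore] -/
theorem exists_lineDatum_three_characters_of_cert_prime [hp : Fact (Nat.Prime 3)] {x₀ s : ℚ}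
    (q : ℕ) [hq : Fact q.Prime] (hq4 : q % 4 = 1) (hq3 : q ≠ 3)
    (hψ : W.Ψ₃.eval x₀ = 0) (hs : s ≠ 0) (hDs : ((q : ℤ) : ℚ) * s ^ 2 = W.Ψ₂Sq.eval x₀) :
    ∃ Φ₀ : AddSubgroup (geomTorsion W ((3 : ℕ) : ℤ)), IsRationalLine W 3 Φ₀ ∧ LineEven W 3 Φ₀ ∧
      (∃ (σ : absoluteGaloisGroup ℚ) (P : W.geomTorsion ((3 : ℕ) : ℤ)), P ∈ Φ₀ ∧ σ • P ≠ P) ∧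
      (∀ (K : Type) [Field K] [NumberField K] [(galRange (K := ℚ) K).Normal],
        Module.finrank ℚ K = 2 →
        (∃ θ : K, θ ^ 2 = algebraMap ℚ K ((-1) ^ ((3 : ℕ) / 2) * (3 : ℕ))) →
        ¬ ∀ v : HeightOneSpectrum (𝓞 ℚ), (((3 : ℕ) : ℕ) : 𝓞 ℚ) ∈ v.asIdeal →
          ∀ 𝔓 ∈ v.primesAbove, ∀ σ ∈ 𝔓.inertia (absoluteGaloisGroup ℚ), ∀ P ∈ Φ₀,
            σ • P = (if σ ∈ galRange (K := ℚ) K then P else -P)) ∧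
      DirichletCharacter.IsPrimitive
        ((quadraticChar (ZMod q)).ringHomComp (Int.castRingHom (ZMod 3)) : DirichletCharacter (ZMod 3) q) ∧
      (∀ (σ : absoluteGaloisGroup ℚ), ∀ P ∈ Φ₀,
        σ • P = (((quadraticChar (ZMod q)).ringHomComp (Int.castRingHom (ZMod 3)) :
          DirichletCharacter (ZMod 3) q) ((modNCyclotomicCharacter ℚ q σ : (ZMod q)ˣ) : ZMod q)).val • P) ∧
      DirichletCharacter.IsPrimitive
        (changeLevel (dvd_mul_right 3 q) (MulChar.ofUnitHom (MonoidHom.id (ZMod 3)ˣ)) *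
          changeLevel (dvd_mul_left q 3)
            ((quadraticChar (ZMod q)).ringHomComp (Int.castRingHom (ZMod 3)) :
              DirichletCharacter (ZMod 3) q)⁻¹ : DirichletCharacter (ZMod 3) (3 * q)) ∧
      (∀ (σ : absoluteGaloisGroup ℚ) (P : W.geomTorsion ((3 : ℕ) : ℤ)),
        σ • P - ((changeLevel (dvd_mul_right 3 q) (MulChar.ofUnitHom (MonoidHom.id (ZMod 3)ˣ)) *
          changeLevel (dvd_mul_left q 3)
            ((quadraticChar (ZMod q)).ringHomComp (Int.castRingHom (ZMod 3)) :
              DirichletCharacter (ZMod 3) q)⁻¹ : DirichletCharacter (ZMod 3) (3 * q))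
          ((modNCyclotomicCharacter ℚ (3 * q) σ : (ZMod (3 * q))ˣ) : ZMod (3 * q))).val • P ∈ Φ₀) := by
  have hqpr : q.Prime := hq.out
  haveI : NeZero q := ⟨hqpr.ne_zero⟩
  have hq2 : q ≠ 2 := by rintro rfl; norm_num at hq4
  have hsq : Squarefree (q : ℤ) := (Nat.prime_iff_prime_int.mp hqpr).squarefree
  have hpos : (0 : ℤ) < q := by exact_mod_cast hqpr.pos
  have h3q : ¬ 3 ∣ q := by
    intro h
    rcases (Nat.dvd_prime hqpr).mp h with h1 | h1
    · norm_num at h1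
    · exact hq3 h1.symm
  have h3q' : ¬ (3 : ℤ) ∣ (q : ℤ) := by
    intro h; exact h3q (by exact_mod_cast h)
  obtain ⟨Φ₀, hΦ, heven, hnt, hram, hχ⟩ :=
    exists_lineDatum_three_kernelField_of_cert hψ hsq hs hDs hpos q hq2 (dvd_refl _) h3q'
  -- `√q` is a square root of `q* = q` (`q ≡ 1 (mod 4)`)
  have hqchar : ringChar (ZMod q) ≠ 2 := by rwa [ZMod.ringChar_zmod_n]
  have hg : geomSqrt ((q : ℤ) : ℚ) ^ 2 = ((quadraticChar (ZMod q) (-1) : ℤ) : AlgebraicClosure ℚ) * q := by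
    rw [geomSqrt_sq, quadraticChar_neg_one hqchar, ZMod.card q, ZMod.χ₄_nat_one_mod_four hq4,
      Int.cast_one, one_mul, Int.cast_natCast, map_natCast]
  have hφprim := X3Branch.legendreCharacter_isPrimitive (p := 3) (q := q) (by decide) hq2
  have hφ0 : ∀ (σ : absoluteGaloisGroup ℚ), ∀ P ∈ Φ₀,
      σ • P = (((quadraticChar (ZMod q)).ringHomComp (Int.castRingHom (ZMod 3)) :
        DirichletCharacter (ZMod 3) q) ((modNCyclotomicCharacter ℚ q σ : (ZMod q)ˣ) : ZMod q)).val • P :=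
    fun σ P hP ↦ X3Branch.smul_eq_legendre_of_kernel_sq_eq_primeStar hΦ hq2 hg hχ σ P hP
  exact ⟨Φ₀, hΦ, heven, hnt, hram, hφprim, hφ0,
    X3Branch.quotCharacter_isPrimitive (p := 3) (by decide) _ hφprim h3q,
    fun σ P ↦ X3Branch.smul_sub_quotCharacter_mem hΦ _ hφ0 σ P⟩

end Summit.BirchSwinnertonDyer.Rank1Residual.Additive

end
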